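import Literature.Probability.RandomPlanarGeometry.SAWCountZdSymbolTopCount
import HarnessLib

/-!
# FIVE-RUN SHAPE CLASSES: on `2j` letters a class with one run of five is the disjoint union of the two one-block classes inside it

Topic `Literature/Probability/RandomPlanarGeometry` (the «SYMBOL POLYNOMIALITY» programme, second layer; on λ1 `SAWCountZdSymbolTopShapes.lean` (`topVec`, `top_block`,
`not_three_axCls`, `bsumW_top_eq_zero`), λ3 `SAWCountZdSymbolTopCount.lean` (`card_shapeClass_top`), η `SAWCountZdSymbolDegree.lean` (`four_le_of_zero_block`)).

PRINTED CONTEXT (locators only; nothing is quoted digit-for-digit). Madras–Slade (1993) §1.1 eq. (1.1.8) p. 5, Definition 1.2.4, §1.2 p. 10; Clisby–Liang–Slade (2007)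
§3.3 eqs. (29)/(31). NOT IN PRINT as far as the lane's desks could locate: the statements below.

THE THEOREM. The second-layer TOP corner `U'_j = secondShapeSumTop j` (`SAWCountZdSymbolSecondCoefficient.lean`) sums the classes on `2j` letters with FOUR adjacencies;
these come in two run types, `{5}` (this file) and `{4,2}` (the sequel `SAWCountZdSymbolSplitRun.lean`). HERE, for `m = 2j` and the five-run vector `fiveVec m s`
(adjacencies at `s, …, s+3`): a class member has its zero block (length exactly four: five is odd) at offset `0` or `1` of the run (★ `mem_topVec_of_mem_fiveVec`);
conversely a one-block class member at either offset satisfies the one extra no-reversal condition automatically, because a reversal there would be a THIRD occurrence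
of a block axis (★ `mem_fiveVec_of_mem_topVec_left/right`, via λ1's `top_block` and `not_three_axCls`); and the two offsets are disjoint (`disjoint_topVec_topVec_succ`).
So ★★ `shapeClass_fiveVec_eq_union` and ★★★ **`card_shapeClass_fiveVec : #shapeClass j (2j) (fiveVec (2j) s) = (2j−5)‼ · 2^{2j−1}`** for every `s + 5 ≤ 2j` (twice λ3's
one-block count; the run-`{5}` part of the lane's census `U'_j`: `4·384 = 1536` of `U'_4 = 3456`, `6·7680` of `U'_5 = 149760`).
Tool notion (the lane's): `fiveVec`.

THIS FILE (lane «pcv-sawmu», a-p1 g26; all PROVED, standard axioms): `fiveVec`, `fiveVec_eq_true_iff`, `adjValid_fiveVec`, `breaks_fiveVec`, `mem_shapeClass_iff`,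
★ `mem_topVec_of_mem_fiveVec`, ★ `mem_fiveVec_of_mem_topVec_left`, ★ `mem_fiveVec_of_mem_topVec_right`, `disjoint_topVec_topVec_succ`, ★★ `shapeClass_fiveVec_eq_union`,
★★★ `card_shapeClass_fiveVec`.
[cite: MadrasSlade1993, §1.1 eq. (1.1.8) p. 5; Definition 1.2.4; §1.2 (p. 10)] [cite: ClisbyLiangSlade2007, §3.3 eqs. (29)/(31)]

Provenance: lane «pcv-sawmu», a-p1 g26 (2026-08-28).
-/

open Finset
open scoped BigOperators
open Literature.Probability.LatticeModels
open Literature.Probability.RandomPlanarGeometry.SAW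
open Literature.Probability.Percolation

namespace Literature.Probability.RandomPlanarGeometry.SAW.Zd

namespace WordTypes

variable {m : ℕ}

/-- The FIVE-RUN adjacency vector: adjacencies at `s, s+1, s+2, s+3` (one run `[s, s+5)`, every other position a run of its own).
[cite: MadrasSlade1993, Definition 1.2.4; lane tool notion] -/
def fiveVec (m s : ℕ) : Fin m → Bool := fun k => decide (s ≤ k.val ∧ k.val ≤ s + 3)

/-- `fiveVec m s k = true ↔ s ≤ k ≤ s + 3`. [cite: MadrasSlade1993, Definition 1.2.4; lane plumbing] -/
theorem fiveVec_eq_true_iff {m s : ℕ} (k : Fin m) : fiveVec m s k = true ↔ s ≤ k.val ∧ k.val ≤ s + 3 := by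
  simp [fiveVec]

/-- `fiveVec m s` is valid when `s + 5 ≤ m`. [cite: MadrasSlade1993, Definition 1.2.4; lane plumbing] -/
theorem adjValid_fiveVec {m s : ℕ} (hs : s + 5 ≤ m) : AdjValid (fiveVec m s) := by
  intro h
  rw [Bool.eq_false_iff, Ne, fiveVec_eq_true_iff]
  simp only
  omega

open Classical in
/-- `fiveVec m s` has four adjacencies, hence `m − 4` breaks (`s + 5 ≤ m`). [cite: MadrasSlade1993, Definition 1.2.4; lane plumbing] -/
theorem breaks_fiveVec {m s : ℕ} (hs : s + 5 ≤ m) : breaks (fiveVec m s) = m - 4 := by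
  unfold breaks
  have htrue : (Finset.univ.filter fun k : Fin m => fiveVec m s k = true) =
      {⟨s, by omega⟩, ⟨s + 1, by omega⟩, ⟨s + 2, by omega⟩, ⟨s + 3, by omega⟩} := by
    ext k
    rw [Finset.mem_filter, fiveVec_eq_true_iff]
    simp only [Finset.mem_univ, true_and, Finset.mem_insert, Finset.mem_singleton, Fin.ext_iff]
    omega
  have h4 : (Finset.univ.filter fun k : Fin m => fiveVec m s k = true).card = 4 := by
    rw [htrue, Finset.card_insert_of_notMem (by simp [Fin.ext_iff]), Finset.card_insert_of_notMem (by simp [Fin.ext_iff]),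
      Finset.card_pair (by simp [Fin.ext_iff])]
  have hsum := Finset.card_filter_add_card_filter_not (s := (Finset.univ : Finset (Fin m))) (fun k : Fin m => fiveVec m s k = true)
  simp only [Finset.card_univ, Fintype.card_fin, Bool.not_eq_true] at hsum
  omega

/-- The membership data of a shape class, unfolded. [cite: MadrasSlade1993, Definition 1.2.4; lane plumbing] -/
theorem mem_shapeClass_iff {j u : ℕ} {A : Fin u → Bool} {κ : Word u u} :
    κ ∈ shapeClass j u A ↔ canon κ = κ ∧ numAxes κ + j = u ∧ (∀ i, IsRep κ i) ∧ RunNoRev A κ ∧ RunHasRep A κ := by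
  classical
  unfold shapeClass
  simp only [Finset.mem_filter, Finset.mem_univ, true_and]

/-- ★ A FIVE-RUN CLASS MEMBER HAS ITS ZERO BLOCK AT OFFSET 0 OR 1 OF THE RUN, and lies in that one-block class.
[cite: MadrasSlade1993, Definition 1.2.4; lane lemma] -/
theorem mem_topVec_of_mem_fiveVec {j s : ℕ} (hs : s + 5 ≤ m) {κ : Word m m} (hκ : κ ∈ shapeClass j m (fiveVec m s)) :
    κ ∈ shapeClass j m (topVec m s) ∨ κ ∈ shapeClass j m (topVec m (s + 1)) := by
  rw [mem_shapeClass_iff] at hκ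
  obtain ⟨hcan, hax, hrep, hnr, i, i', hii', hi', hA, hpos⟩ := hκ
  have h4 := four_le_of_zero_block _ κ hnr hii' hi' hA hpos
  -- the block lies inside the run `[s, s+5)`
  have h1 := hA ⟨i, by omega⟩ le_rfl (by simp only; omega)
  have h2 := hA ⟨i' - 2, by omega⟩ (by simp only; omega) (by simp only; omega)
  rw [fiveVec_eq_true_iff] at h1 h2
  simp only at h1 h2
  -- its length is even (odd blocks never sum to zero), hence exactly four
  have hz : bsumW κ i i' = 0 := (wordPos_eq_iff_bsumW κ hii'.le hi').1 hpos
  have hlen : i' = i + 4 := by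
    by_contra hne
    have h5 : i' = i + 5 := by omega
    exact bsumW_ne_zero_of_odd κ hi' (by rw [h5]; omega) hz
  subst hlen
  have hi_s : i = s ∨ i = s + 1 := by omega
  -- run-wise reversal-freeness and the block transfer to `topVec m i`
  have key : ∀ t, (t = s ∨ t = s + 1) → i = t → κ ∈ shapeClass j m (topVec m t) := by
    intro t ht hit
    subst hit
    rw [mem_shapeClass_iff]
    refine ⟨hcan, hax, hrep, fun k hk hAk => hnr k hk ?_, ⟨i, i + 4, hii', hi', fun k hk hk' => (topVec_eq_true_iff k).2 ⟨hk, by omega⟩, hpos⟩⟩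
    rw [topVec_eq_true_iff] at hAk
    rw [fiveVec_eq_true_iff]
    omega
  rcases hi_s with h | h
  · exact Or.inl (key s (Or.inl rfl) h)
  · exact Or.inr (key (s + 1) (Or.inr rfl) h)

/-- ★ A ONE-BLOCK CLASS MEMBER AT OFFSET 0 OF THE RUN IS A FIVE-RUN CLASS MEMBER (`m = 2j`): the extra pair `(s+3, s+4)` cannot be a reversal, since the letter at
`s+3` is `ȳ` and a `y` at `s+4` would be a third occurrence of that axis. [cite: MadrasSlade1993, Definition 1.2.4; lane lemma] -/
theorem mem_fiveVec_of_mem_topVec_left {j s : ℕ} (hm : m = 2 * j) (hs : s + 5 ≤ m) {κ : Word m m} (hκ : κ ∈ shapeClass j m (topVec m s)) :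
    κ ∈ shapeClass j m (fiveVec m s) := by
  obtain ⟨h2, h3, hne⟩ := top_block hm hκ (by omega)
  have hκ' := hκ
  rw [mem_shapeClass_iff] at hκ' ⊢
  obtain ⟨hcan, hax, hrep, hnr, -⟩ := hκ'
  refine ⟨hcan, hax, hrep, fun k hk hAk => ?_, ⟨s, s + 4, by omega, by omega, fun k hk hk' => (fiveVec_eq_true_iff k).2 ⟨hk, by omega⟩,
    (bsumW_top_eq_zero hκ).2 |> fun h => (wordPos_eq_iff_bsumW κ (by omega) (by omega)).2 h⟩⟩
  rw [fiveVec_eq_true_iff] at hAk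
  by_cases hk3 : k.val = s + 3
  · -- the new pair `(s+3, s+4)`
    have hs4 : s + 4 < m := by omega
    have hs3 : s + 3 < m := by omega
    have e1 : (⟨k.val + 1, hk⟩ : Fin m) = ⟨s + 4, hs4⟩ := Fin.ext (by simp only; omega)
    rw [e1]
    have e0 : k = ⟨s + 3, hs3⟩ := Fin.ext hk3
    rw [e0]
    intro heq
    rw [h3] at heq
    simp only [Bool.not_not] at heq
    -- `κ (s+4) = κ (s+1)`: a third position on the axis of `s+1`
    exact not_three_axCls hm hκ (a := ⟨s + 1, by omega⟩) (b := ⟨s + 3, by omega⟩) (c := ⟨s + 4, by omega⟩)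
      (by simp [Fin.ext_iff]) (by simp [Fin.ext_iff]) (by simp [Fin.ext_iff]) (by rw [h3]) (by rw [heq])
  · exact hnr k hk ((topVec_eq_true_iff k).2 ⟨hAk.1, by omega⟩)

/-- ★ … and at offset 1: the extra pair `(s, s+1)` cannot be a reversal (an `x̄` at `s` would be a third occurrence of the block axis `x`).
[cite: MadrasSlade1993, Definition 1.2.4; lane lemma] -/
theorem mem_fiveVec_of_mem_topVec_right {j s : ℕ} (hm : m = 2 * j) (hs : s + 5 ≤ m) {κ : Word m m} (hκ : κ ∈ shapeClass j m (topVec m (s + 1))) :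
    κ ∈ shapeClass j m (fiveVec m s) := by
  obtain ⟨h2, h3, hne⟩ := top_block hm hκ (by omega)
  have hκ' := hκ
  rw [mem_shapeClass_iff] at hκ' ⊢
  obtain ⟨hcan, hax, hrep, hnr, -⟩ := hκ'
  refine ⟨hcan, hax, hrep, fun k hk hAk => ?_, ⟨s + 1, s + 1 + 4, by omega, by omega, fun k hk hk' => (fiveVec_eq_true_iff k).2 ⟨by omega, by omega⟩,
    (bsumW_top_eq_zero hκ).2 |> fun h => (wordPos_eq_iff_bsumW κ (by omega) (by omega)).2 h⟩⟩
  rw [fiveVec_eq_true_iff] at hAk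
  by_cases hk0 : k.val = s
  · -- the new pair `(s, s+1)`: `κ (s+1) = rev (κ s)` iff `κ s = rev (κ (s+1)) = κ (s+3)`
    have hs1 : s + 1 < m := by omega
    have hs0 : s < m := by omega
    have e1 : (⟨k.val + 1, hk⟩ : Fin m) = ⟨s + 1, hs1⟩ := Fin.ext (by simp only; omega)
    rw [e1]
    have e0 : k = ⟨s, hs0⟩ := Fin.ext hk0
    rw [e0]
    intro heq
    have hs3 : κ ⟨s + 1 + 2, by omega⟩ = ((κ ⟨s + 1, by omega⟩).1, !(κ ⟨s + 1, by omega⟩).2) := h2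
    have hax0 : (κ ⟨s, by omega⟩).1 = (κ ⟨s + 1, by omega⟩).1 := by
      have := congrArg Prod.fst heq; simpa using this.symm
    exact not_three_axCls hm hκ (a := ⟨s + 1, by omega⟩) (b := ⟨s + 1 + 2, by omega⟩) (c := ⟨s, by omega⟩)
      (by simp [Fin.ext_iff]) (by simp [Fin.ext_iff]) (by simp [Fin.ext_iff]; omega) (by rw [hs3]) hax0
  · exact hnr k hk ((topVec_eq_true_iff k).2 ⟨by omega, by omega⟩)

/-- The two one-block classes inside a five-run are DISJOINT (`m = 2j`): blocks at both offsets would put the axis of `s` at `s`, `s+2`, `s+4`.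
[cite: MadrasSlade1993, Definition 1.2.4; lane lemma] -/
theorem disjoint_topVec_topVec_succ {j s : ℕ} (hm : m = 2 * j) (hs : s + 5 ≤ m) :
    Disjoint (shapeClass j m (topVec m s)) (shapeClass j m (topVec m (s + 1))) := by
  rw [Finset.disjoint_left]
  intro κ h0 h1
  obtain ⟨a2, -, -⟩ := top_block hm h0 (by omega)
  obtain ⟨b2, -, -⟩ := top_block hm h1 (by omega)
  -- `κ (s+2) = rev κ s` and `κ (s+3) = rev κ (s+1)` [offset 0]; `κ (s+1+2) = rev κ (s+1)` … we need `κ (s+4) = rev κ (s+2)` from offset 1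
  have hb : κ ⟨s + 1 + 3, by omega⟩ = ((κ ⟨s + 1 + 1, by omega⟩).1, !(κ ⟨s + 1 + 1, by omega⟩).2) := (top_block hm h1 (by omega)).2.1
  have e1 : (⟨s + 1 + 1, by omega⟩ : Fin m) = ⟨s + 2, by omega⟩ := Fin.ext (by simp)
  have e2 : (⟨s + 1 + 3, by omega⟩ : Fin m) = ⟨s + 4, by omega⟩ := Fin.ext (by simp)
  rw [e1, e2] at hb
  have hax24 : (κ ⟨s + 4, by omega⟩).1 = (κ ⟨s, by omega⟩).1 := by rw [hb, a2]
  have hax2 : (κ ⟨s + 2, by omega⟩).1 = (κ ⟨s, by omega⟩).1 := by rw [a2]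
  exact not_three_axCls hm h0 (a := ⟨s, by omega⟩) (b := ⟨s + 2, by omega⟩) (c := ⟨s + 4, by omega⟩)
    (by simp [Fin.ext_iff]) (by simp [Fin.ext_iff]) (by simp [Fin.ext_iff]) hax2 hax24

/-- ★★ THE FIVE-RUN CLASS IS THE DISJOINT UNION OF THE TWO ONE-BLOCK CLASSES INSIDE IT (`m = 2j`, `s + 5 ≤ m`).
[cite: MadrasSlade1993, Definition 1.2.4; lane theorem] -/
theorem shapeClass_fiveVec_eq_union {j s : ℕ} (hm : m = 2 * j) (hs : s + 5 ≤ m) :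
    shapeClass j m (fiveVec m s) = shapeClass j m (topVec m s) ∪ shapeClass j m (topVec m (s + 1)) := by
  ext κ
  rw [Finset.mem_union]
  constructor
  · exact mem_topVec_of_mem_fiveVec hs
  · rintro (h | h)
    · exact mem_fiveVec_of_mem_topVec_left hm hs h
    · exact mem_fiveVec_of_mem_topVec_right hm hs h

/-- ★★★ THE FIVE-RUN CLASS COUNT: `#shapeClass j (2j) (fiveVec (2j) s) = (2j−5)‼ · 2^{2j−1}` for every `s + 5 ≤ 2j` (twice λ3's one-block count:
`384` per five-run vector at `j = 4`, `4·384 = 1536` of `U'_4 = 3456`). [cite: MadrasSlade1993, Definition 1.2.4; lane theorem] -/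
theorem card_shapeClass_fiveVec {j s : ℕ} (hs : s + 5 ≤ 2 * j) :
    (shapeClass j (2 * j) (fiveVec (2 * j) s)).card = (2 * j - 5).doubleFactorial * 2 ^ (2 * j - 1) := by
  rw [shapeClass_fiveVec_eq_union rfl hs, Finset.card_union_of_disjoint (disjoint_topVec_topVec_succ rfl hs),
    card_shapeClass_top (by omega), card_shapeClass_top (by omega)]
  have : 2 ^ (2 * j - 1) = 2 ^ (2 * j - 2) * 2 := by rw [← pow_succ]; congr 1; omega
  rw [this]; ring

end WordTypes

end Literature.Probability.RandomPlanarGeometry.SAW.Zd
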